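import Literature.Analysis.FluidPDE.NSEssEndpointLR
import Literature.Analysis.FluidPDE.CKNEpsilonRegularityHolds
import Literature.Analysis.FluidPDE.NSGaldiEnergyEqualityHolds
import Literature.Analysis.FluidPDE.NSSuitableESSPressureProofs
import Literature.Analysis.FluidPDE.CheskidovShvydkoyRegularProofs
import HarnessLib

/-!
# The Escauriaza–Seregin–Šverák endpoint criterion, reduced to Theorem 1.4 and Kato's `L³` theory

Analysis/FluidPDE proof file (theorems only) on the discharge path of the named fact **ns.S08**
`Literature.Analysis.FluidPDE.ess_endpoint` (`NSLerayHopf.lean`; Escauriaza–Seregin–Šverák 2003,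
Thm. 1.3 with the uniqueness clause). The accepted assembly
`ess_endpoint_of_ESS_theory_LR` (`NSEssEndpointLR.lean`) proves `ess_endpoint` from six named
facts, following ESS 2003, §3 (proof of Thm. 1.3 from Thm. 1.4): the local theorem
`ess_local_holder` (ESS Thm. 1.4), the ε-regularity criterion `lemarieRieusset_epsilon_regularity`
(Caffarelli–Kohn–Nirenberg; Lemarié-Rieusset 2016, Thm. 14.4 = ESS Lemma 2.2), the associated
pressure `ess_associated_pressure` (ESS (3.2)–(3.4)), Kato's local `L³` theory `ess_kato_L3_local`
(ESS Thm. 7.4), the energy equality `galdi_energy_equality` (Galdi 2018 = ESS (1.4) in `L⁴(Q_T)`),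
and Ladyzhenskaya–Prodi–Serrin regularity `ladyzhenskaya_prodi_serrin` (ESS Thm. 1.2).

Four of the six are now theorems of the tree:
`lemarieRieusset_epsilon_regularity_holds` (`CKNEpsilonRegularityHolds`),
`ess_associated_pressure_holds` (`NSSuitableESSPressureProofs`),
`galdi_energy_equality_holds` (`NSGaldiEnergyEqualityHolds`) and
`ladyzhenskaya_prodi_serrin_holds` (`CheskidovShvydkoyRegularProofs`). This file records the
resulting reduction: **`ess_endpoint` follows from ESS Theorem 1.4 and ESS Theorem 7.4 alone**
(`ess_endpoint_of_local_holder_of_kato`), together with the corresponding reductions of the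
intermediate statements (3.6) `ess_sup_bound` and (1.14) `ess_L5_integrability`. No statement is
changed; no named fact is introduced.

## References

* L. Escauriaza, G. Seregin, V. Šverák, *`L_{3,∞}`-solutions of Navier–Stokes equations and
  backward uniqueness*, Russ. Math. Surveys 58:2 (2003), 211–250: Thm. 1.3 and its proof in §3
  ((3.1)–(3.6), (1.14)), Thm. 1.4, Thm. 7.4 with Remark 7.5.
-/

noncomputable section

open MeasureTheory Set

namespace Literature.Analysis.FluidPDE

/-- **ESS (3.5)–(3.6) from Theorem 1.4 alone**: boundedness away from `t = 0` of `L_{3,∞}`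
Leray–Hopf solutions, `ess_sup_bound`, follows from the local theorem `ess_local_holder`
(ESS 2003, Thm. 1.4), the ε-regularity criterion and the associated pressure being theorems
(`lemarieRieusset_epsilon_regularity_holds`, `ess_associated_pressure_holds`). Real proof
(`ess_sup_bound_of_LR`). [cite: EscauriazaSereginSverak2003, §3 (3.5)–(3.6)] -/
theorem ess_sup_bound_of_local_holder (hLH : ess_local_holder) : ess_sup_bound :=
  ess_sup_bound_of_LR hLH lemarieRieusset_epsilon_regularity_holds ess_associated_pressure_holds

/-- **ESS (1.14) from Theorems 1.4 and 7.4**: the `L₅(Q_T)` integrability of `L_{3,∞}`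
Leray–Hopf solutions follows from `ess_local_holder` and `ess_kato_L3_local`, the energy equality
being a theorem (`galdi_energy_equality_holds`). Real proof
(`ess_L5_integrability_of_sup_bound`). [cite: EscauriazaSereginSverak2003, §3 (1.14)] -/
theorem ess_L5_integrability_of_local_holder_of_kato (hLH : ess_local_holder)
    (hK : ess_kato_L3_local) : ess_L5_integrability :=
  ess_L5_integrability_of_sup_bound (ess_sup_bound_of_local_holder hLH) hK galdi_energy_equality_holds

/-- **The endpoint criterion from ESS Theorems 1.4 and 7.4** (Escauriaza–Seregin–Šverák 2003,
Thm. 1.3 with uniqueness): `ess_endpoint` follows from the local Hölder regularity of `L_{3,∞}`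
solutions (`ess_local_holder`, Thm. 1.4) and Kato's short-time `L³` theory (`ess_kato_L3_local`,
Thm. 7.4 / Remark 7.5); the four other ingredients of the accepted assembly
`ess_endpoint_of_ESS_theory_LR` — ε-regularity (Lemma 2.2), associated pressure ((3.2)–(3.4)),
energy equality ((1.4) for `L⁴(Q_T)` solutions) and Ladyzhenskaya–Prodi–Serrin regularity
(Thm. 1.2) — are theorems of the tree. Real proof. [cite: EscauriazaSereginSverak2003, Thm. 1.3, §3] -/
theorem ess_endpoint_of_local_holder_of_kato (hLH : ess_local_holder) (hK : ess_kato_L3_local) :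
    ess_endpoint :=
  ess_endpoint_of_ESS_theory_LR hLH lemarieRieusset_epsilon_regularity_holds
    ess_associated_pressure_holds hK galdi_energy_equality_holds ladyzhenskaya_prodi_serrin_holds


end Literature.Analysis.FluidPDE
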